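import Literature.AlgebraicGeometry.Milne1999.LefschetzCentraliserBiproducts
import Literature.AlgebraicGeometry.Pohlmann1968.SimpleCMAbelianVarietyPowersDivisorGenerated
import HarnessLib

/-!
# Milne 1999, Theorem 3.2 in the torus case WITH MULTIPLICITIES: the `S(A)`-invariants of a product of
# powers of CM abelian varieties are Lefschetz classes (Lemma 3.8 on a biproduct of CM realisations)

Family `hodge`, layer `Literature/AlgebraicGeometry/Milne1999`, namespace
`Literature.AlgebraicGeometry.Milne1999` (D-0022). THEOREMS ONLY (no definition, no named fact; D-0026).
Written for the cell `pub-hodgecm2` (COR-CM), seat `lit-milne`, binder table `HOME/lit/milne.md` rows M2/M4.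
Sequel of `Milne1999/SpecialLefschetzGroupInvariantsCM` (the case of ONE realisation with `θ(K) ⊆ C(A)`, i.e.
a simple CM abelian variety: every weight `ξ_σ` of the torus `S(A)` has multiplicity one) and of
`Milne1999/SpecialLefschetzGroupInvariantsCMSimple` (transport along isogenies).  Here the weights have
MULTIPLICITIES: the abelian variety is a finite biproduct `B = ⨁_{i<n+1} A_{c(i)}` of copies of realisations
`(A_c, ι_c, θ_c)` of CM types `(K_c; Φ_c)` indexed by "isogeny classes" `c`, with `Hom(A_c, A_{c'}) = 0` for
`c ≠ c'` and `End(A_c)` commutative — Milne's `A₁^{r₁} × ⋯ × A_s^{r_s}` with the `Aᵢ` simple of CM type and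
pairwise non-isogenous (Prop. 1.1), up to the order of the factors.  The cited record
`Milne1999_specialLefschetzGroup_invariants_le` (Cor. 4.5 with Thm. 4.4 and Thm. 3.2, for EVERY complex abelian
variety) rests for non-CM `A` on the invariant theory of `Sp`, `O`, `GL` (Prop. 3.6) and stays a record; this
file PROVES its conclusion on all such `B`, on all powers `X^{N+1}` of a simple complex abelian variety `X` of
CM type, and on everything isogenous to such a `B`.

## Source, verbatim

J. S. Milne, *Lefschetz classes on abelian varieties*, Duke Math. J. 96 (1999) 639–675
[`paper:doi-10-1215-s0012-7094-99-09620-5`, held; PDF page = printed page − 638]: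

* §1 p. 643 (p0005 L12–L16, L27–L31): "For any positive integer `r`, `V(A^r) = rV(A)`, and the diagonal action
  of `C(A)` on `rV(A)` identifies `C(A)` with `C(A^r)` (as `k`-algebras with involution). Let `A = A₁ × ⋯ × A_s`.
  Then `C(A) ⊂ C(A₁) × ⋯ × C(A_s)`, with equality holding if and only if `Hom(Aᵢ, Aⱼ) = 0` for all `i, j`,
  `i ≠ j`. […] Proposition 1.1. Let `A₁, …, A_s` be a set of representatives for the simple isogeny factors of
  `A`, so that there exists an isogeny `A₁^{r₁} × ⋯ × A_s^{r_s} → A` for some `rᵢ > 0`. Any such isogeny induces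
  an isomorphism `C(A₁) × ⋯ × C(A_s) → C(A)` of `k`-algebras with involution".
* Thm. 3.2 (p. 653, p0015 L22–23): "For any abelian variety `A` over `Ω` and integer `r ≥ 0`, the `k`-algebra
  `H*(A^r)^{S(A)}` is generated by divisor classes."
* Lemma 3.8 and the torus case (pp. 656–657, p0018 L33 – p0019 L22): "Lemma 3.8. Let `Ξ` be the set of weights
  of `T` in `V`, and assume that the elements of `Ξ` can be numbered `ξ₁, …, ξ_{2m}` in such a way that the
  `ℤ`-module of relations among the `ξᵢ` is generated by the relations `ξᵢ + ξ_{m+i} = 0`, `i = 1, …, m`. Then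
  `(⋀V)^T` is generated as a `Ω`-algebra by `(⋀²V)^T`. […] `[Σ] = 0` if and only if `nᵢ = n_{m+i}` for
  `i = 1, …, m`, and so `[Σ] = 0 ⟹ V(Σ) = ⊗ᵢ (V_{ξᵢ} ⊗ V_{ξ_{m+i}})^{⊗nᵢ}`. But
  `V_{ξᵢ} ⊗ V_{ξ_{m+i}} ⊂ (⋀²V)^T` […] the weights of `S(A)` in `H¹(A) ⊗ k^al` are precisely the characters
  `ξ_σ`, `σ ∈ Hom(K, k^al)`, and each has the same multiplicity. […] We can now apply Lemma 3.8 to deduce that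
  `H*(A^r)^{S(A)}` is generated as a `k`-algebra by `H²(A^r)^{S(A)}`."
* Cor. 4.5 and p. 659 (p0021 L24–30): "Corollary 4.5. For any abelian variety `A` and any `r ≥ 0`,
  `H^{2*}(A^r)(*)^{L(A)} = D_hom(A^r)_k`. […] the kernel of `l(A)` […] equals `S(A)`."

## What is proved (complex `B`, Betti cohomology, read on `H¹`; the tree's carriers)

Data: a type `C` of "classes", for each `c : C` a realisation `(A_c, ι_c, θ_c)` of a CM type `(K_c; Φ_c)`
(`ComplexMultiplication.IsCMTypeRealisation`), hypotheses `hOrth : Hom(A_c, A_{c'}) = 0` for `c ≠ c'` and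
`hComm : End(A_c)` commutative, and a map `cls : Fin (n+1) → C`; `B = ⨁ᵢ A_{cls i}`.

* `biproduct_map_comp_eq_comp_of_classes` — the CLASS-DIAGONAL action `Θ(a) = ⊕ᵢ ι_{cls i}(a_{cls i})`
  (`a ∈ ∏_c 𝓞_{K_c}`) is central in `End(B)` ("`C(A₁) × ⋯ × C(A_s) → C(A)`", Prop. 1.1); hence
  (`comp_comm_of_forall_comp_comm_of_diagonal`, linear algebra) every operator diagonal on the eigenbasis
  `w_{(i,σ)} = πᵢ^* v_{cls i, σ}` of `H¹(B)` whose eigenvalue depends only on the WEIGHT `(cls i, σ)` commutes with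
  every `ψ^*`, `ψ ∈ End(B)`.
* `exists_torusElement_unitaryCentralizerGroup_biproduct` — **the cocharacters of `S(B)` with multiplicities**:
  for every weight `ω = (c, φ)` the automorphism `u_ω` of `H¹(B)` acting by `2` on ALL `w_{(i,φ)}` with
  `cls i = c`, by `2⁻¹` on all `w_{(i,φ̄)}` with `cls i = c`, and by `1` elsewhere lies in
  `S(B)(ℂ) = unitaryCentralizerGroup B (Σᵢ πᵢ^* h_{cls i})` for Rosati-compatible classes `h_c` (block form of
  `Q`, `Milne1999/LefschetzCentraliserBiproducts`), and its weight on a `2p`-set `Δ` of indices is `1` iff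
  `#{y ∈ Δ of weight ω} = #{y ∈ Δ of weight ω̄}` ("`[Σ] = 0` if and only if `nᵢ = n_{m+i}`").
* `mem_pohlmannDivisorSetsAlg_of_forall_card_filter_eq` — **Lemma 3.8's bookkeeping with multiplicities**: a
  `2p`-set of indices balanced for every weight is a disjoint union of `p` pairs `{(i,φ), (j,φ̄)}` with
  `cls i = cls j`, each a balanced pair of the tree's Pohlmann CM-algebra index sets
  (`pair_mem_pohlmannSetsAlg_of_weight_eq`).
* **`mem_divisorClassesSpan_biproduct_of_forall_exteriorPullback_eq`** — Prop. 3.4 with Prop. 3.3 on `B`: a class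
  `x ∈ H^{2p}(B(ℂ); ℂ)` fixed by `⋀^{2p}u` for every `u ∈ S(B)(ℂ)` lies in `Dᵖ(B) ⊗ ℂ` (the `u_ω` force the
  support of `x` in the monomial basis to be balanced; `Dᵖ(B) ⊗ ℂ` is the span of the monomials over disjoint
  unions of balanced pairs, the tree's `Pohlmann1968.divisorClassesSpan_biproduct_eq_iSup`).
* **`specialLefschetzGroup_invariants_le_biproduct_of_classes`** — the conclusion of the record
  `Milne1999_specialLefschetzGroup_invariants_le` for `B`: every class fixed by `specialLefschetzGroup (dim B) B.X`
  lies in `Dᵖ_hom(B)_ℂ`; `exists_polarization_invariants_le_biproduct_of_classes` (the same with the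
  polarization exposed, for transport); corollaries `…_biproduct_of_hom_eq_zero` (pairwise Hom-orthogonal
  realisations with commutative `End`), `…_biproduct_const` (`⨁_{Fin (n+1)} A`, one realisation),
  `…_of_isIsogeny_of_forall` (transport along an isogeny onto such a target),
  **`specialLefschetzGroup_invariants_le_powSucc_of_isSimple_of_isOfCMType`** (every power `X^{N+1}` of a simple
  complex abelian variety of CM type, no realisation data) and `isDivisorGenerated_powSucc_of_hodgeGroup_eq_…`
  (Prop. 4.8 (c) ⇒ (a) on the powers, record-free).

NOT here: the general (non-CM) case of the record (Prop. 3.6); the regrouping of an arbitrary CM abelian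
variety into such a `B` (Poincaré decomposition) is left to a sequel.

## References

* [Milne1999LefschetzClasses] J. S. Milne, Lefschetz classes on abelian varieties, Duke Math. J. 96 (1999)
  639–675: §1 p. 643 and Prop. 1.1, Thm. 3.2, Props. 3.3–3.4, Lemma 3.8 and p. 657, Thm. 4.4, Cor. 4.5,
  Prop. 4.8 (pp. 659–660).
* [Pohlmann1968] H. Pohlmann, Algebraic cycles on abelian varieties of complex multiplication type, Ann. of
  Math. (2) 88 (1968) 161–180, Thm. 1.
* [GaoUllmo2025] Z. Gao, E. Ullmo, J. Inst. Math. Jussieu 25 (2025), Thm. 3.1 (Pohlmann for a CM algebra).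
* [Gordon1999HodgeAVSurvey] B. B. Gordon, A survey of the Hodge conjecture for abelian varieties, §9.2, 9.2.2.
* [Shimura1998] G. Shimura, Abelian Varieties with Complex Multiplication and Modular Functions (1998), §6.2
  Thm. 4 (3), §5.1 Lemma 3.
* [MumfordAV1970] D. Mumford, Abelian Varieties, §19 Cor. 2 of Thm. 1 (p. 174).
-/

noncomputable section

open CategoryTheory CategoryTheory.Limits NumberField
open Literature.AlgebraicTopology.SingularHomology
open Literature.AlgebraicGeometry.HodgeTheory
open Literature.AlgebraicGeometry.Motives
open Literature.AlgebraicGeometry.ComplexMultiplication (IsCMTypeRealisation)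
open Literature.AlgebraicGeometry.VanGeemen1994 (hodgeClassSpan pullbackOne)
open Literature.AlgebraicGeometry.Pohlmann1968
open Literature.Barriers.HodgeConjecture (divisorClassesSpan)
open Literature.Geometry.Kaehler (lefschetzPow)
open Literature.NumberTheory.NumberFields (exists_ringOfIntegers_separating_embeddings)
open NumberField.ComplexEmbedding (conjugate)

namespace Literature.AlgebraicGeometry.Milne1999

/-! ### §1 Linear algebra: operators diagonal on a basis -/

section LinearAlgebra

variable {I M : Type*} [Fintype I] [AddCommGroup M] [Module ℂ M]

/-- If `f` is diagonal on the basis `b` with eigenvalues `c i` and `f x = μ x`, then the `b`-coordinates of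
`x` vanish at every `i` with `c i ≠ μ` (eigenspaces of a diagonal operator are spanned by basis vectors).
[cite: Milne1999LefschetzClasses, §3 Lemma 3.8 (proof: "`V = ⊕ V_χ`")] -/
theorem repr_eq_zero_of_apply_eq_smul_of_apply_eq_smul (b : Module.Basis I ℂ M) {f : M →ₗ[ℂ] M}
    {c : I → ℂ} (hf : ∀ i, f (b i) = c i • b i) {x : M} {μ : ℂ} (hx : f x = μ • x) {i : I}
    (hi : c i ≠ μ) : b.repr x i = 0 := by
  have h1 : f x = ∑ j, (b.repr x j * c j) • b j := by
    conv_lhs => rw [← b.sum_repr x]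
    simp only [map_sum, map_smul, hf, smul_smul]
  have h2 : μ • x = ∑ j, (μ * b.repr x j) • b j := by
    conv_lhs => rw [← b.sum_repr x]
    simp only [Finset.smul_sum, smul_smul]
  have hx' : ∑ j, (b.repr x j * c j - μ * b.repr x j) • b j = 0 := by
    simp only [sub_smul]
    rw [Finset.sum_sub_distrib, ← h1, ← h2, hx, sub_self]
  have h := Fintype.linearIndependent_iff.1 b.linearIndependent _ hx' i
  rw [mul_comm μ, ← mul_sub, mul_eq_zero] at h
  rcases h with h | h
  · exact h
  · exact absurd (sub_eq_zero.1 h) hi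

/-- **An operator commuting with a diagonalisable commutative family commutes with every operator that is
diagonal on the same basis and constant on the joint eigenvalue classes of the family**: if the `F r` are
diagonal on `b` (`F r (b i) = λ_{r,i} b i`), `T` commutes with every `F r`, `D` is diagonal on `b` with
eigenvalues `d i`, and `d i ≠ d j` only when some `F r` separates `i` from `j`, then `T D = D T` (`T bᵢ` lies
in the joint eigenspace of `bᵢ`, on which `D` is the scalar `d i`).  The step "`C(A) ⊗ ℂ ⊇` the operators that
are scalar on the weight spaces of the centre" of Milne's `C(A₁) × ⋯ × C(A_s) → C(A)`.
[cite: Milne1999LefschetzClasses, §1 Prop. 1.1 and Remark 1.2 (p. 643)] -/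
theorem comp_comm_of_forall_comp_comm_of_diagonal {R : Type*} (b : Module.Basis I ℂ M)
    {F : R → (M →ₗ[ℂ] M)} {lam : R → I → ℂ} (hF : ∀ r i, F r (b i) = lam r i • b i)
    {T : M →ₗ[ℂ] M} (hT : ∀ r, T ∘ₗ F r = F r ∘ₗ T) {D : M →ₗ[ℂ] M} {d : I → ℂ}
    (hD : ∀ i, D (b i) = d i • b i) (hd : ∀ i j, d i ≠ d j → ∃ r, lam r i ≠ lam r j) :
    T ∘ₗ D = D ∘ₗ T := by
  refine b.ext fun i => ?_
  rw [LinearMap.comp_apply, LinearMap.comp_apply, hD, map_smul]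
  -- the coordinates of `T bᵢ` vanish off the joint eigenvalue class of `i`
  have hzero : ∀ j, d j ≠ d i → b.repr (T (b i)) j = 0 := by
    intro j hj
    obtain ⟨r, hr⟩ := hd j i hj
    have hev : F r (T (b i)) = lam r i • T (b i) := by
      rw [← LinearMap.comp_apply, ← hT r, LinearMap.comp_apply, hF, map_smul]
    exact repr_eq_zero_of_apply_eq_smul_of_apply_eq_smul b (hF r) hev hr
  conv_rhs => rw [← b.sum_repr (T (b i))]
  conv_lhs => rw [← b.sum_repr (T (b i))]
  rw [map_sum, Finset.smul_sum]
  refine Finset.sum_congr rfl fun j _ => ?_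
  rw [map_smul, hD, smul_smul, smul_smul, mul_comm (d i)]
  by_cases hj : d j = d i
  · rw [hj]
  · rw [hzero j hj, zero_mul, zero_mul]

end LinearAlgebra

/-! ### §2 The class-diagonal action of `∏_c 𝓞_{K_c}` on `B = ⨁ᵢ A_{cls i}` is central in `End(B)` -/

section Centre

variable {C : Type} {K' : C → Type} [∀ c, Field (K' c)] [∀ c, NumberField (K' c)]
  {A' : C → AbelianVariety ℂ} {ι' : ∀ c, 𝓞 (K' c) →+* End (A' c)} {n : ℕ}

omit [∀ c, NumberField (K' c)] in
/-- **The class-diagonal endomorphisms `Θ(a) = ⊕ᵢ ι_{cls i}(a_{cls i})` of `B = ⨁ᵢ A_{cls i}` commute with every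
endomorphism of `B`** when `Hom(A_c, A_{c'}) = 0` for `c ≠ c'` and each `End(A_c)` is commutative: block by block,
`ι_{cls i}(a) ≫ f = f ≫ ι_{cls j}(a)` for `f = ιᵢ ≫ ψ ≫ πⱼ : A_{cls i} → A_{cls j}` — zero if `cls i ≠ cls j`, an
endomorphism of `A_{cls i}` otherwise (Milne: "`C(A) ⊂ C(A₁) × ⋯ × C(A_s)`, with equality holding if and only if
`Hom(Aᵢ, Aⱼ) = 0`"; "the diagonal action of `C(A)` on `rV(A)` identifies `C(A)` with `C(A^r)`").
[cite: Milne1999LefschetzClasses, §1 p. 643 and Prop. 1.1] -/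
theorem biproduct_map_comp_eq_comp_of_classes (hOrth : ∀ c c', c ≠ c' → ∀ f : A' c ⟶ A' c', f = 0)
    (hComm : ∀ (c) (f g : A' c ⟶ A' c), f ≫ g = g ≫ f) (cls : Fin (n + 1) → C) (a : ∀ c, 𝓞 (K' c))
    (ψ : (⨁ fun i => A' (cls i)) ⟶ ⨁ fun i => A' (cls i)) :
    biproduct.map (fun i => ι' (cls i) (a (cls i))) ≫ ψ = ψ ≫ biproduct.map fun i => ι' (cls i) (a (cls i)) := by
  classical
  have key : ∀ (c c' : C) (f : A' c ⟶ A' c'), ι' c (a c) ≫ f = f ≫ ι' c' (a c') := by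
    intro c c' f
    by_cases e : c = c'
    · subst e
      exact hComm c _ _
    · rw [hOrth c c' e f, Limits.comp_zero, Limits.zero_comp]
  refine biproduct.hom_ext' _ _ fun i => biproduct.hom_ext _ _ fun j => ?_
  simp only [Category.assoc, biproduct.ι_map_assoc, biproduct.map_π]
  have e := key (cls i) (cls j)
    (biproduct.ι (fun i => A' (cls i)) i ≫ ψ ≫ biproduct.π (fun i => A' (cls i)) j)
  simpa only [Category.assoc] using e

/-- `(φ ≫ ψ)^* = φ^* ∘ ψ^*` on `H¹`, in `Module.End` (contravariance). [cite: HatcherAT2002, §3.2 Prop. 3.10] -/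
private theorem pullbackOne_comp'' {B : AbelianVariety ℂ} (φ ψ : B ⟶ B) :
    pullbackOne B (φ ≫ ψ) = pullbackOne B φ * pullbackOne B ψ := by
  change (complexBetti.map (φ.hom.hom.hom ≫ ψ.hom.hom.hom) 1).hom = _
  rw [complexBetti.map_comp, ModuleCat.hom_comp]
  rfl

omit [∀ c, NumberField (K' c)] in
/-- Hence **`ψ^*` commutes with `Θ(a)^*` on `H¹(B)`** for every `ψ ∈ End(B)` (`Θ(a)^* ∈ C(B) ⊗ ℂ`, and the
`ψ^*` centralise `C(B)`). [cite: Milne1999LefschetzClasses, §1 pp. 642–643 (C(A) and Prop. 1.1)] -/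
theorem pullbackOne_comp_pullbackOne_biproduct_map_comm
    (hOrth : ∀ c c', c ≠ c' → ∀ f : A' c ⟶ A' c', f = 0) (hComm : ∀ (c) (f g : A' c ⟶ A' c), f ≫ g = g ≫ f)
    (cls : Fin (n + 1) → C) (a : ∀ c, 𝓞 (K' c)) (ψ : (⨁ fun i => A' (cls i)) ⟶ ⨁ fun i => A' (cls i)) :
    pullbackOne (⨁ fun i => A' (cls i)) ψ ∘ₗ
        pullbackOne (⨁ fun i => A' (cls i)) (biproduct.map fun i => ι' (cls i) (a (cls i))) =
      pullbackOne (⨁ fun i => A' (cls i)) (biproduct.map fun i => ι' (cls i) (a (cls i))) ∘ₗ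
        pullbackOne (⨁ fun i => A' (cls i)) ψ := by
  change pullbackOne _ ψ * pullbackOne _ _ = pullbackOne _ _ * pullbackOne _ ψ
  rw [← pullbackOne_comp'', ← pullbackOne_comp'', biproduct_map_comp_eq_comp_of_classes hOrth hComm cls a ψ]

/-- **Two distinct weights `(c, σ) ≠ (c', σ')` of `∏_c K_c` are separated by an integral element**: some
`a ∈ ∏_c 𝓞_{K_c}` has `σ(a_c) ≠ σ'(a_{c'})` (different slots: `a = (…, 1, …, 0, …)`; the same slot: an
integral generator separating the embeddings of `K_c`). [cite: Milne2020HodgeClassesAV, 1.2 (a)] -/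
theorem exists_weight_apply_ne {ℓ₁ ℓ₂ : (c : C) × (K' c →+* ℂ)} (h : ℓ₁ ≠ ℓ₂) :
    ∃ a : ∀ c, 𝓞 (K' c),
      ℓ₁.2 ((a ℓ₁.1 : 𝓞 (K' ℓ₁.1)) : K' ℓ₁.1) ≠ ℓ₂.2 ((a ℓ₂.1 : 𝓞 (K' ℓ₂.1)) : K' ℓ₂.1) := by
  classical
  obtain ⟨c₁, σ₁⟩ := ℓ₁
  obtain ⟨c₂, σ₂⟩ := ℓ₂
  by_cases hc : c₁ = c₂
  · subst hc
    have hσ : σ₁ ≠ σ₂ := fun e => h (by rw [e])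
    obtain ⟨β, hβ⟩ := exists_ringOfIntegers_separating_embeddings (F := K' c₁)
    refine ⟨Function.update (fun c => (1 : 𝓞 (K' c))) c₁ β, ?_⟩
    simp only [Function.update_self]
    exact fun e => hσ (hβ e)
  · refine ⟨Function.update (fun c => (1 : 𝓞 (K' c))) c₂ 0, ?_⟩
    simp only [Function.update_self, Function.update_of_ne hc]
    simp

end Centre

/-! ### §3 Weights and labels: `(i, σ) ↦ (cls i, σ)`, complex conjugation `(c, σ) ↦ (c, σ̄)` -/

section Labels

variable {C : Type} {K' : C → Type} [∀ c, Field (K' c)] [∀ c, NumberField (K' c)] [∀ c, IsCMField (K' c)]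

omit [∀ c, NumberField (K' c)] [∀ c, IsCMField (K' c)] in
/-- The conjugate weight differs from the weight: `(c, σ̄) ≠ (c, σ)` (`σ̄ ≠ σ` for a CM type). [folklore] -/
private theorem conj_label_ne (Φ' : ∀ c, CMType (K' c)) (c : C) (ρ : K' c →+* ℂ) :
    (⟨c, conjugate ρ⟩ : (c : C) × (K' c →+* ℂ)) ≠ ⟨c, ρ⟩ := by
  intro h
  have h' : conjugate ρ = ρ := eq_of_heq (Sigma.mk.inj_iff.1 h).2
  have h2 := (Φ' c).2 ρ
  rw [h'] at h2
  exact iff_not_self h2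

omit [∀ c, NumberField (K' c)] [∀ c, IsCMField (K' c)] in
/-- Conjugation of weights is an involution. [folklore] -/
private theorem conj_label_conj_label (ω : (c : C) × (K' c →+* ℂ)) :
    (⟨ω.1, conjugate (conjugate ω.2)⟩ : (c : C) × (K' c →+* ℂ)) = ω := by
  obtain ⟨c, ρ⟩ := ω
  exact Sigma.ext rfl (heq_of_eq (star_star ρ))

omit [∀ c, NumberField (K' c)] [∀ c, IsCMField (K' c)] in
/-- `(c, σ̄) = ω ↔ (c, σ) = ω̄`. [folklore] -/
private theorem conj_label_eq_iff (c : C) (ρ : K' c →+* ℂ) (ω : (c : C) × (K' c →+* ℂ)) :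
    (⟨c, conjugate ρ⟩ : (c : C) × (K' c →+* ℂ)) = ω ↔
      (⟨c, ρ⟩ : (c : C) × (K' c →+* ℂ)) = ⟨ω.1, conjugate ω.2⟩ := by
  constructor
  · rintro rfl
    change (⟨c, ρ⟩ : (c : C) × (K' c →+* ℂ)) = ⟨c, conjugate (conjugate ρ)⟩
    rw [show conjugate (conjugate ρ) = ρ from star_star ρ]
  · intro h
    obtain ⟨c', ρ'⟩ := ω
    cases h
    exact Sigma.ext rfl (heq_of_eq (star_star ρ'))

omit [∀ c, NumberField (K' c)] [∀ c, IsCMField (K' c)] in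
/-- `(c, σ̄) = ω̄ ↔ (c, σ) = ω`. [folklore] -/
private theorem conj_label_eq_conj_label_iff (c : C) (ρ : K' c →+* ℂ) (ω : (c : C) × (K' c →+* ℂ)) :
    (⟨c, conjugate ρ⟩ : (c : C) × (K' c →+* ℂ)) = ⟨ω.1, conjugate ω.2⟩ ↔
      (⟨c, ρ⟩ : (c : C) × (K' c →+* ℂ)) = ω := by
  rw [conj_label_eq_iff]
  change (⟨c, ρ⟩ : (c : C) × (K' c →+* ℂ)) = ⟨ω.1, conjugate (conjugate ω.2)⟩ ↔ _
  rw [conj_label_conj_label]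

/-- Counting the members of a pair with a property (`Finset.card` form). [folklore] -/
private theorem card_filter_pair {α : Type*} [DecidableEq α] {a b : α} (hab : a ≠ b) (Q : α → Prop)
    [DecidablePred Q] :
    ((({a, b} : Finset α)).filter Q).card = (if Q a then 1 else 0) + (if Q b then 1 else 0) := by
  rw [Finset.filter_insert, Finset.filter_singleton]
  by_cases ha : Q a <;> by_cases hb : Q b <;> simp [ha, hb, hab]

/-- Counting the members of a pair with a property (`Set.ncard` form). [folklore] -/
private theorem ncard_sep_pair {α : Type*} [DecidableEq α] {a b : α} (hab : a ≠ b) (Q : α → Prop)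
    [DecidablePred Q] :
    {x | x ∈ ({a, b} : Finset α) ∧ Q x}.ncard = (if Q a then 1 else 0) + (if Q b then 1 else 0) := by
  rw [show {x | x ∈ ({a, b} : Finset α) ∧ Q x} = ↑(({a, b} : Finset α).filter Q) by rw [Finset.coe_filter],
    Set.ncard_coe_finset, card_filter_pair hab]

/-- For `τ ∈ Aut(ℂ)` and a weight `(c, σ)`: `τ ∘ σ̄` lies in the type `Φ_c` iff `τ ∘ σ` does not
(`τ ∘ σ̄ = (τ ∘ σ)‾` on a CM field, and `φ ∈ Φ ↔ φ̄ ∉ Φ`). [cite: Shimura1998, §5.1 Lemma 3 and §8.1 Prop. 25] -/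
private theorem comp_conj_mem_type_iff (Φ' : ∀ c, CMType (K' c)) (τ : ℂ ≃+* ℂ) (c : C) (ρ : K' c →+* ℂ) :
    (τ : ℂ →+* ℂ).comp (conjugate ρ) ∈ (Φ' c).1 ↔ (τ : ℂ →+* ℂ).comp ρ ∉ (Φ' c).1 := by
  rw [comp_conjugate_eq]
  have h := (Φ' c).2 ((τ : ℂ →+* ℂ).comp ρ)
  constructor
  · intro h1 h2
    exact h.1 h2 h1
  · intro h2
    by_contra h1
    exact h2 (h.2 h1)

variable {n : ℕ} (Φ' : ∀ c, CMType (K' c)) (cls : Fin (n + 1) → C)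

open scoped Classical in
/-- **A cross-slot conjugate pair `{(i, φ), (j, φ̄)}` with `cls i = cls j` is a balanced pair** of the CM
algebra `∏ᵢ K_{cls i}` (`∈ pohlmannSetsAlg (Φ ∘ cls) 1`): for every `τ ∈ Aut(ℂ)` exactly one of `τ ∘ φ`,
`τ ∘ φ̄ = (τ ∘ φ)‾` lies in `Φ_{cls i} = Φ_{cls j}` — these pairs index the divisor classes
`w_{(i,φ)} ∧ w_{(j,φ̄)}` of the product ("`V_{ξᵢ} ⊗ V_{ξ_{m+i}} ⊂ (⋀²V)^T`").
[cite: Milne1999LefschetzClasses, §3 Lemma 3.8] [cite: Gordon1999HodgeAVSurvey, §9.2 (9.2.1) and 9.2.2] -/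
theorem pair_mem_pohlmannSetsAlg_of_weight_eq {y₀ y₁ : (i : Fin (n + 1)) × (K' (cls i) →+* ℂ)}
    (h : (⟨cls y₁.1, y₁.2⟩ : (c : C) × (K' c →+* ℂ)) = ⟨cls y₀.1, conjugate y₀.2⟩) :
    ({y₀, y₁} : Finset ((i : Fin (n + 1)) × (K' (cls i) →+* ℂ))) ∈ pohlmannSetsAlg (fun i => Φ' (cls i)) 1 := by
  classical
  have hne : y₀ ≠ y₁ := by
    rintro rfl
    exact conj_label_ne Φ' (cls y₀.1) y₀.2 h.symm
  refine ⟨Finset.card_pair hne, fun τ => ?_⟩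
  -- the membership predicate factors through the weight `(cls i, σ)`
  have key : ∀ (c c' : C) (ρ : K' c →+* ℂ) (ρ' : K' c' →+* ℂ),
      (⟨c', ρ'⟩ : (c : C) × (K' c →+* ℂ)) = ⟨c, conjugate ρ⟩ →
      ((τ : ℂ →+* ℂ).comp ρ' ∈ (Φ' c').1 ↔ (τ : ℂ →+* ℂ).comp ρ ∉ (Φ' c).1) := by
    intro c c' ρ ρ' e
    cases e
    exact comp_conj_mem_type_iff Φ' τ c ρ
  have h1 : (τ : ℂ →+* ℂ).comp y₁.2 ∈ ((fun i => Φ' (cls i)) y₁.1).1 ↔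
      (τ : ℂ →+* ℂ).comp y₀.2 ∉ ((fun i => Φ' (cls i)) y₀.1).1 :=
    key (cls y₀.1) (cls y₁.1) y₀.2 y₁.2 h
  rw [ncard_sep_pair hne, ncard_sep_pair hne]
  by_cases h0 : (τ : ℂ →+* ℂ).comp y₀.2 ∈ ((fun i => Φ' (cls i)) y₀.1).1
  · have h1' : (τ : ℂ →+* ℂ).comp y₁.2 ∉ ((fun i => Φ' (cls i)) y₁.1).1 := fun h' => (h1.1 h') h0
    simp [h0, h1']
  · have h1' : (τ : ℂ →+* ℂ).comp y₁.2 ∈ ((fun i => Φ' (cls i)) y₁.1).1 := h1.2 h0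
    simp [h0, h1']

omit [∀ c, NumberField (K' c)] [∀ c, IsCMField (K' c)] in
open scoped Classical in
/-- A cross-slot conjugate pair is balanced FOR EVERY WEIGHT: `#{y ∈ {y₀, y₁} of weight ω} =
#{y ∈ {y₀, y₁} of weight ω̄}`. [folklore] -/
private theorem card_filter_pair_weight_eq {y₀ y₁ : (i : Fin (n + 1)) × (K' (cls i) →+* ℂ)} (hne : y₀ ≠ y₁)
    (h : (⟨cls y₁.1, y₁.2⟩ : (c : C) × (K' c →+* ℂ)) = ⟨cls y₀.1, conjugate y₀.2⟩)
    (ω : (c : C) × (K' c →+* ℂ)) :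
    (({y₀, y₁} : Finset ((i : Fin (n + 1)) × (K' (cls i) →+* ℂ))).filter fun y =>
        (⟨cls y.1, y.2⟩ : (c : C) × (K' c →+* ℂ)) = ω).card =
      (({y₀, y₁} : Finset ((i : Fin (n + 1)) × (K' (cls i) →+* ℂ))).filter fun y =>
        (⟨cls y.1, y.2⟩ : (c : C) × (K' c →+* ℂ)) = ⟨ω.1, conjugate ω.2⟩).card := by
  rw [card_filter_pair hne, card_filter_pair hne, h]
  simp only [conj_label_eq_iff (cls y₀.1) y₀.2 ω, conj_label_eq_conj_label_iff (cls y₀.1) y₀.2 ω]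
  rw [add_comm]

open scoped Classical in
/-- **Lemma 3.8's bookkeeping with multiplicities**: a `2p`-set `Δ` of indices `(i, σ)` such that, for every
weight `ω = (c, φ)`, `Δ` has as many members of weight `ω` as of weight `ω̄ = (c, φ̄)` ("`[Σ] = 0` if and only if
`nᵢ = n_{m+i}`") is a disjoint union of `p` cross-slot conjugate pairs `{(i, φ), (j, φ̄)}`, `cls i = cls j` —
hence a member of the tree's `pohlmannDivisorSetsAlg (Φ ∘ cls) p`, the index set of `Dᵖ(B) ⊗ ℂ`
("`V(Σ) = ⊗ᵢ (V_{ξᵢ} ⊗ V_{ξ_{m+i}})^{⊗nᵢ}`"). [cite: Milne1999LefschetzClasses, §3 Lemma 3.8 (p. 657)]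
[cite: Gordon1999HodgeAVSurvey, 9.2.2] -/
theorem mem_pohlmannDivisorSetsAlg_of_forall_card_filter_eq :
    ∀ (p : ℕ) (s : Finset ((i : Fin (n + 1)) × (K' (cls i) →+* ℂ))), s.card = 2 * p →
      (∀ ω : (c : C) × (K' c →+* ℂ),
        (s.filter fun y => (⟨cls y.1, y.2⟩ : (c : C) × (K' c →+* ℂ)) = ω).card =
          (s.filter fun y => (⟨cls y.1, y.2⟩ : (c : C) × (K' c →+* ℂ)) = ⟨ω.1, conjugate ω.2⟩).card) →
      s ∈ pohlmannDivisorSetsAlg (fun i => Φ' (cls i)) p := by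
  classical
  intro p
  induction p with
  | zero =>
    intro s hcard _
    rw [pohlmannDivisorSetsAlg_def, mem_disjointUnionsOf_zero]
    exact Finset.card_eq_zero.1 hcard
  | succ m ih =>
    intro s hcard hbal
    obtain ⟨y₀, hy₀⟩ : s.Nonempty := by
      rw [← Finset.card_pos, hcard]; omega
    -- a partner of conjugate weight
    set ω : (c : C) × (K' c →+* ℂ) := ⟨cls y₀.1, y₀.2⟩ with hω
    have hpos : 0 < (s.filter fun y =>
        (⟨cls y.1, y.2⟩ : (c : C) × (K' c →+* ℂ)) = ⟨ω.1, conjugate ω.2⟩).card := by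
      rw [← hbal ω, Finset.card_pos]
      exact ⟨y₀, Finset.mem_filter.2 ⟨hy₀, rfl⟩⟩
    obtain ⟨y₁, hy₁⟩ := Finset.card_pos.1 hpos
    rw [Finset.mem_filter] at hy₁
    have hpair : (⟨cls y₁.1, y₁.2⟩ : (c : C) × (K' c →+* ℂ)) = ⟨cls y₀.1, conjugate y₀.2⟩ := hy₁.2
    have hne : y₀ ≠ y₁ := by
      rintro rfl
      exact conj_label_ne Φ' (cls y₀.1) y₀.2 hpair.symm
    set t : Finset ((i : Fin (n + 1)) × (K' (cls i) →+* ℂ)) := {y₀, y₁} with ht_def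
    have ht : t ∈ pohlmannSetsAlg (fun i => Φ' (cls i)) 1 := pair_mem_pohlmannSetsAlg_of_weight_eq Φ' cls hpair
    have htΔ : t ⊆ s := by
      intro x hx
      rw [ht_def, Finset.mem_insert, Finset.mem_singleton] at hx
      rcases hx with rfl | rfl
      · exact hy₀
      · exact hy₁.1
    have hdisj : Disjoint (s \ t) t := Finset.sdiff_disjoint
    have hΔeq : s = (s \ t).disjUnion t hdisj := by
      rw [Finset.disjUnion_eq_union, Finset.sdiff_union_of_subset htΔ]
    have hcard' : (s \ t).card = 2 * m := by
      rw [Finset.card_sdiff_of_subset htΔ, hcard, ht.1]; omega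
    -- the rest is still balanced for every weight
    have hsplit : ∀ Q : ((i : Fin (n + 1)) × (K' (cls i) →+* ℂ)) → Prop, ∀ [DecidablePred Q],
        (s.filter Q).card = ((s \ t).filter Q).card + (t.filter Q).card := by
      intro Q _
      conv_lhs => rw [hΔeq, Finset.disjUnion_eq_union]
      rw [Finset.filter_union, Finset.card_union_of_disjoint (Finset.disjoint_filter_filter hdisj)]
    have hpairbal : ∀ ω' : (c : C) × (K' c →+* ℂ),
        (t.filter fun y => (⟨cls y.1, y.2⟩ : (c : C) × (K' c →+* ℂ)) = ω').card =
          (t.filter fun y => (⟨cls y.1, y.2⟩ : (c : C) × (K' c →+* ℂ)) = ⟨ω'.1, conjugate ω'.2⟩).card :=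
      fun ω' => by rw [ht_def]; exact card_filter_pair_weight_eq cls hne hpair ω'
    have hbal' : ∀ ω' : (c : C) × (K' c →+* ℂ),
        ((s \ t).filter fun y => (⟨cls y.1, y.2⟩ : (c : C) × (K' c →+* ℂ)) = ω').card =
          ((s \ t).filter fun y =>
            (⟨cls y.1, y.2⟩ : (c : C) × (K' c →+* ℂ)) = ⟨ω'.1, conjugate ω'.2⟩).card := by
      intro ω'
      have e := hbal ω'
      rw [hsplit, hsplit, hpairbal ω'] at e
      omega
    rw [hΔeq, pohlmannDivisorSetsAlg_def, mem_disjointUnionsOf_succ]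
    exact ⟨s \ t, (pohlmannDivisorSetsAlg_def (fun i => Φ' (cls i)) m) ▸ ih (s \ t) hcard' hbal', t, ht, hdisj,
      rfl⟩

end Labels

/-! ### §4 The cocharacters of the torus `S(B)` of a biproduct of CM realisations (with multiplicities) -/

section Torus

variable {C : Type} {K' : C → Type} [∀ c, Field (K' c)] [∀ c, NumberField (K' c)] [∀ c, IsCMField (K' c)]
  {Φ' : ∀ c, CMType (K' c)} {A' : C → AbelianVariety ℂ} {ι' : ∀ c, 𝓞 (K' c) →+* End (A' c)}
  {θ' : ∀ c, K' c →+* Module.End ℂ (complexBetti (A' c).X 1)} {n : ℕ} {cls : Fin (n + 1) → C}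

omit [∀ c, IsCMField (K' c)] in
/-- A realisation has positive dimension (`b₁ = [K:ℚ] ≥ 1`). [folklore] -/
private theorem dim_pos_of_isCMTypeRealisation' {c : C} (hA : IsCMTypeRealisation (Φ' c) (A' c) (ι' c) (θ' c)) :
    0 < (A' c).dim := by
  have h1 := AbelianVariety.finrank_complexBetti_one (A' c)
  rw [hA.2.1] at h1
  have h2 : 0 < Module.finrank ℚ (K' c) := Module.finrank_pos
  omega

/-- The weight of `2^{[· = ω]} · 2^{-[· = ω̄]}` on a finite set of indices: `∏ = 2^{N(ω)} · (2⁻¹)^{N(ω̄)}`.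
[folklore] -/
private theorem prod_weight_eq {Y L : Type*} [DecidableEq L] (lab : Y → L) (ω ω' : L) (s : Finset Y) :
    ∏ y ∈ s, ((if lab y = ω then (2 : ℂ) else 1) * (if lab y = ω' then (2 : ℂ)⁻¹ else 1)) =
      (2 : ℂ) ^ (s.filter fun y => lab y = ω).card * ((2 : ℂ)⁻¹) ^ (s.filter fun y => lab y = ω').card := by
  rw [Finset.prod_mul_distrib, Finset.prod_ite, Finset.prod_ite, Finset.prod_const_one, Finset.prod_const_one,
    mul_one, mul_one, Finset.prod_const, Finset.prod_const]

/-- `2^{N₁} · (2⁻¹)^{N₂} = 1` forces `N₁ = N₂`. [folklore] -/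
private theorem eq_of_two_pow_mul_inv_pow_eq_one {N₁ N₂ : ℕ}
    (h : (2 : ℂ) ^ N₁ * ((2 : ℂ)⁻¹) ^ N₂ = 1) : N₁ = N₂ := by
  have h2 : ((2 : ℂ)) ^ N₂ ≠ 0 := pow_ne_zero _ two_ne_zero
  have e : (2 : ℂ) ^ N₁ = (2 : ℂ) ^ N₂ := by
    have := congrArg (· * (2 : ℂ) ^ N₂) h
    simp only [one_mul, mul_assoc, inv_pow, inv_mul_cancel₀ h2, mul_one] at this
    exact this
  have e' : ((2 ^ N₁ : ℕ) : ℂ) = ((2 ^ N₂ : ℕ) : ℂ) := by push_cast; exact e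
  exact Nat.pow_right_injective le_rfl (Nat.cast_injective e')

open scoped Classical in
/-- **The cocharacters of `S(B)` with multiplicities.**  Let `B = ⨁ᵢ A_{cls i}` be a biproduct of copies of
pairwise `Hom`-orthogonal CM realisations with commutative endomorphism rings, `w_{(i,σ)} = πᵢ^* v_{cls i,σ}` the
eigenbasis of `H¹(B(ℂ); ℂ)` built from `ι`-eigenbases `v_c` of the factors, and `hᵢ = h_{cls i}` Rosati-compatible
classes.  For every weight `ω = (c, φ)` the diagonal automorphism `u_ω` with eigenvalue `2` on the `w_{(i,φ)}`,
`cls i = c`, `2⁻¹` on the `w_{(i,φ̄)}`, `cls i = c`, and `1` elsewhere lies in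
`S(B)(ℂ) = unitaryCentralizerGroup B (Σᵢ πᵢ^* hᵢ)`: it commutes with every `ψ^*` (its eigenvalue depends only on
the weight, §2), and preserves `Q_D` (block form of `Q_D`: `Q_D(w_y, w_{y'}) ≠ 0` only for `y, y'` in the same
slot with conjugate embeddings, where `d_y d_{y'} = 2 · 2⁻¹ = 1`).  Its weight on a set `Δ` of indices,
`∏_{y ∈ Δ} d_y = 2^{N_Δ(ω)} 2^{-N_Δ(ω̄)}`, is `1` iff `N_Δ(ω) = N_Δ(ω̄)` — "the weights of `S(A)` in `H¹(A) ⊗ k^al`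
are precisely the characters `ξ_σ` […] and each has the same multiplicity", "`[Σ] = 0` if and only if
`nᵢ = n_{m+i}`". [cite: Milne1999LefschetzClasses, §3 Lemma 3.8 and p. 657, §1 p. 643–645]
[cite: Milne1999, §2 Prop. 2.5 (proof)] -/
theorem exists_torusElement_unitaryCentralizerGroup_biproduct
    (hA : ∀ c, IsCMTypeRealisation (Φ' c) (A' c) (ι' c) (θ' c))
    (hOrth : ∀ c c', c ≠ c' → ∀ f : A' c ⟶ A' c', f = 0) (hComm : ∀ (c) (f g : A' c ⟶ A' c), f ≫ g = g ≫ f)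
    {v : ∀ c, Module.Basis (K' c →+* ℂ) ℂ (complexBetti (A' c).X 1)}
    (hv' : ∀ (c) (σ : K' c →+* ℂ) (a : 𝓞 (K' c)),
      complexBetti.map (ι' c a).hom.hom.hom 1 (v c σ) = σ (a : K' c) • v c σ)
    {w : Module.Basis ((i : Fin (n + 1)) × (K' (cls i) →+* ℂ)) ℂ (complexBetti (⨁ fun i => A' (cls i)).X 1)}
    (hw : ∀ y, w y = complexBetti.map (biproduct.π (fun i => A' (cls i)) y.1).hom.hom.hom 1 (v (cls y.1) y.2))
    {h : ∀ c, complexBetti (A' c).X 2}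
    (hros : ∀ (c) (a ac : 𝓞 (K' c)), (ac : K' c) = IsCMField.complexConj (K' c) (a : K' c) →
      ∀ x y : complexBetti (A' c).X 1,
        polarizationPairingOne (A' c).X (h c) ((A' c).dim - 1) (complexBetti.map (ι' c a).hom.hom.hom 1 x) y =
          polarizationPairingOne (A' c).X (h c) ((A' c).dim - 1) x (complexBetti.map (ι' c ac).hom.hom.hom 1 y))
    (ω : (c : C) × (K' c →+* ℂ)) :
    ∃ u ∈ unitaryCentralizerGroup (⨁ fun i => A' (cls i))
        (sumPolarizationClass (fun i => A' (cls i)) fun i => h (cls i)),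
      ∃ d : ((i : Fin (n + 1)) × (K' (cls i) →+* ℂ)) → ℂ, (∀ y, u (w y) = d y • w y) ∧
        ∀ s : Finset ((i : Fin (n + 1)) × (K' (cls i) →+* ℂ)), ∏ y ∈ s, d y = 1 →
          (s.filter fun y => (⟨cls y.1, y.2⟩ : (c : C) × (K' c →+* ℂ)) = ω).card =
            (s.filter fun y => (⟨cls y.1, y.2⟩ : (c : C) × (K' c →+* ℂ)) = ⟨ω.1, conjugate ω.2⟩).card := by
  classical
  set lab : ((i : Fin (n + 1)) × (K' (cls i) →+* ℂ)) → (c : C) × (K' c →+* ℂ) :=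
    fun y => ⟨cls y.1, y.2⟩ with hlab
  set ω' : (c : C) × (K' c →+* ℂ) := ⟨ω.1, conjugate ω.2⟩ with hω'
  have hne : ω' ≠ ω := by
    obtain ⟨c, φ⟩ := ω
    exact conj_label_ne Φ' c φ
  -- the weights `d_y`: `2` on weight `ω`, `2⁻¹` on weight `ω̄`, `1` elsewhere
  set D : ((c : C) × (K' c →+* ℂ)) → ℂ := fun ℓ =>
    (if ℓ = ω then (2 : ℂ) else 1) * (if ℓ = ω' then (2 : ℂ)⁻¹ else 1) with hD_def
  set d : ((i : Fin (n + 1)) × (K' (cls i) →+* ℂ)) → ℂ := fun y => D (lab y) with hd_def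
  have hD0 : ∀ ℓ, D ℓ ≠ 0 := fun ℓ => by
    simp only [hD_def]
    split_ifs <;> norm_num
  have hd0 : ∀ y, d y ≠ 0 := fun y => hD0 _
  -- the diagonal automorphism
  set c₀ : ((i : Fin (n + 1)) × (K' (cls i) →+* ℂ)) → ℂˣ := fun y => Units.mk0 (d y) (hd0 y) with hc₀
  set u : complexBetti (⨁ fun i => A' (cls i)).X 1 ≃ₗ[ℂ] complexBetti (⨁ fun i => A' (cls i)).X 1 :=
    w.equiv (w.unitsSMul c₀) (Equiv.refl _) with hu_def
  have hd : ∀ y, u (w y) = d y • w y := fun y => by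
    rw [hu_def, Module.Basis.equiv_apply, Equiv.refl_apply, Module.Basis.unitsSMul_apply, Units.smul_def, hc₀,
      Units.val_mk0]
  -- `D` is a unitary weight: `D(ℓ) D(ℓ̄) = 1`
  have hD1 : ∀ (c : C) (ρ : K' c →+* ℂ),
      D ⟨c, ρ⟩ * D ⟨c, conjugate ρ⟩ = 1 := by
    intro c ρ
    have e1 : ((⟨c, conjugate ρ⟩ : (c : C) × (K' c →+* ℂ)) = ω) ↔ ((⟨c, ρ⟩ : (c : C) × (K' c →+* ℂ)) = ω') :=
      conj_label_eq_iff c ρ ω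
    have e2 : ((⟨c, conjugate ρ⟩ : (c : C) × (K' c →+* ℂ)) = ω') ↔ ((⟨c, ρ⟩ : (c : C) × (K' c →+* ℂ)) = ω) :=
      conj_label_eq_conj_label_iff c ρ ω
    set ℓ : (c : C) × (K' c →+* ℂ) := ⟨c, ρ⟩ with hℓ
    by_cases h1 : ℓ = ω
    · have h2 : ℓ ≠ ω' := fun h => hne (h.symm.trans h1)
      have h3 : (⟨c, conjugate ρ⟩ : (c : C) × (K' c →+* ℂ)) ≠ ω := fun h => h2 (e1.1 h)
      have h4 : (⟨c, conjugate ρ⟩ : (c : C) × (K' c →+* ℂ)) = ω' := e2.2 h1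
      simp only [hD_def, if_pos h1, if_neg h2, if_neg h3, if_pos h4]
      norm_num
    · by_cases h2 : ℓ = ω'
      · have h3 : (⟨c, conjugate ρ⟩ : (c : C) × (K' c →+* ℂ)) = ω := e1.2 h2
        have h4 : (⟨c, conjugate ρ⟩ : (c : C) × (K' c →+* ℂ)) ≠ ω' := fun h => h1 (e2.1 h)
        simp only [hD_def, if_neg h1, if_pos h2, if_pos h3, if_neg h4]
        norm_num
      · have h3 : (⟨c, conjugate ρ⟩ : (c : C) × (K' c →+* ℂ)) ≠ ω := fun h => h2 (e1.1 h)
        have h4 : (⟨c, conjugate ρ⟩ : (c : C) × (K' c →+* ℂ)) ≠ ω' := fun h => h1 (e2.1 h)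
        simp only [hD_def, if_neg h1, if_neg h2, if_neg h3, if_neg h4]
        norm_num
  -- the class-diagonal action and its eigenvalues on `w`
  have hF : ∀ (a : ∀ c, 𝓞 (K' c)) (y : (i : Fin (n + 1)) × (K' (cls i) →+* ℂ)),
      pullbackOne (⨁ fun i => A' (cls i)) (biproduct.map fun i => ι' (cls i) (a (cls i))) (w y) =
        (lab y).2 ((a (lab y).1 : 𝓞 (K' (lab y).1)) : K' (lab y).1) • w y := by
    intro a y
    change complexBetti.map (biproduct.map fun i => ι' (cls i) (a (cls i))).hom.hom.hom 1 (w y) = _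
    rw [hw y, map_biproductMap_map_π, hv', map_smul]
  -- (1) `u ∈ C(B)`: it commutes with every `ψ^*`
  have huC : u ∈ centralizerGroup (⨁ fun i => A' (cls i)) := by
    rw [mem_centralizerGroup_iff]
    intro ψ x
    have key := comp_comm_of_forall_comp_comm_of_diagonal (R := ∀ c, 𝓞 (K' c)) w
      (F := fun a => pullbackOne (⨁ fun i => A' (cls i)) (biproduct.map fun i => ι' (cls i) (a (cls i))))
      (lam := fun a y => (lab y).2 ((a (lab y).1 : 𝓞 (K' (lab y).1)) : K' (lab y).1)) hF
      (T := pullbackOne (⨁ fun i => A' (cls i)) ψ)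
      (fun a => pullbackOne_comp_pullbackOne_biproduct_map_comm hOrth hComm cls a ψ)
      (D := (u : complexBetti (⨁ fun i => A' (cls i)).X 1 →ₗ[ℂ] complexBetti (⨁ fun i => A' (cls i)).X 1))
      (d := d) (fun y => by rw [LinearEquiv.coe_coe, hd]) (fun y y' hyy' => by
        have hl : lab y ≠ lab y' := fun e => hyy' (by simp only [hd_def, e])
        exact exists_weight_apply_ne hl)
    have e := LinearMap.congr_fun key x
    rw [LinearMap.comp_apply, LinearMap.comp_apply, LinearEquiv.coe_coe] at e
    exact e.symm
  -- (2) `u` preserves `Q_D`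
  have h0 : ∀ i : Fin (n + 1), 0 < (A' (cls i)).dim := fun i => dim_pos_of_isCMTypeRealisation' (hA (cls i))
  have hQ : ∀ y y', polarizationPairingOne (⨁ fun i => A' (cls i)).X
      (sumPolarizationClass (fun i => A' (cls i)) fun i => h (cls i)) ((⨁ fun i => A' (cls i)).dim - 1)
        (w y) (w y') ≠ 0 → d y * d y' = 1 := by
    rintro ⟨i, σ⟩ ⟨j, τ⟩ hQ
    by_cases hij : i = j
    · subst hij
      by_cases hτ : τ = conjugate σ
      · subst hτ
        exact hD1 (cls i) σ
      · exfalso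
        apply hQ
        rw [hw, hw]
        exact polarizationPairingOne_sum_map_π_map_π_eq_zero (fun i => A' (cls i)) (fun i => h (cls i)) h0 i _ _
          (polarizationPairingOne_basis_eq_zero_of_ne_conjugate (hv' (cls i)) (hros (cls i)) hτ)
    · exfalso
      apply hQ
      rw [hw, hw]
      exact polarizationPairingOne_sum_map_π_map_π_of_ne (fun i => A' (cls i)) (fun i => h (cls i)) h0 hij _ _
  have huS : u ∈ unitaryCentralizerGroup (⨁ fun i => A' (cls i))
      (sumPolarizationClass (fun i => A' (cls i)) fun i => h (cls i)) :=
    ⟨huC, fun x z => polarizationPairingOne_apply_apply_eq_of_basis w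
      (u := (u : complexBetti (⨁ fun i => A' (cls i)).X 1 →ₗ[ℂ] complexBetti (⨁ fun i => A' (cls i)).X 1))
      (fun y => by rw [LinearEquiv.coe_coe, hd]) hQ x z⟩
  refine ⟨u, huS, d, hd, fun s hs => ?_⟩
  -- (3) the weight on `s`
  have hprod : ∏ y ∈ s, d y = (2 : ℂ) ^ (s.filter fun y => lab y = ω).card *
      ((2 : ℂ)⁻¹) ^ (s.filter fun y => lab y = ω').card := by
    simp only [hd_def, hD_def]
    exact prod_weight_eq lab ω ω' s
  rw [hprod] at hs
  exact eq_of_two_pow_mul_inv_pow_eq_one hs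

end Torus

/-! ### §5 Prop. 3.4 with Prop. 3.3 on `B = ⨁ᵢ A_{cls i}`: `S(B)`-invariants are divisor classes -/

section Main

variable {C : Type} {K' : C → Type} [∀ c, Field (K' c)] [∀ c, NumberField (K' c)] [∀ c, IsCMField (K' c)]
  {Φ' : ∀ c, CMType (K' c)} {A' : C → AbelianVariety ℂ} {ι' : ∀ c, 𝓞 (K' c) →+* End (A' c)}
  {θ' : ∀ c, K' c →+* Module.End ℂ (complexBetti (A' c).X 1)} {n : ℕ}

/-- **Milne 1999, Prop. 3.4 with Prop. 3.3 (Theorem 3.2) for `B = ⨁ᵢ A_{cls i}`** — copies of pairwise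
`Hom`-orthogonal CM realisations with commutative `End` — and Rosati-compatible classes `h_c`: a class
`x ∈ H^{2p}(B(ℂ); ℂ)` fixed by `⋀^{2p} u` for every `u ∈ S(B)(ℂ) = unitaryCentralizerGroup B (Σᵢ πᵢ^* h_{cls i})`
lies in `Dᵖ(B) ⊗ ℂ = divisorClassesSpan B.X (dim B) p`.  Proof = Lemma 3.8 with multiplicities: in the monomial
basis `w_Δ` of `H^{2p}(B) = ⋀^{2p} H¹(B)` on the eigenbasis `w_{(i,σ)} = πᵢ^* v_{cls i,σ}`, the cocharacter `u_ω`
of §4 multiplies `w_Δ` by `2^{N_Δ(ω) - N_Δ(ω̄)}`, so the support of `x` consists of `Δ` balanced for every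
weight; such `Δ` are disjoint unions of cross-slot conjugate pairs (§3), and `Dᵖ(B) ⊗ ℂ` is the span of the
`w_Δ` over the disjoint unions of balanced pairs (the tree's `Pohlmann1968.divisorClassesSpan_biproduct_eq_iSup`,
whose degree-`2` input is Prop. 3.3 for `B`). [cite: Milne1999LefschetzClasses, Thm. 3.2, Props. 3.3–3.4,
Lemma 3.8 and p. 657] [cite: Pohlmann1968, Thm. 1] [cite: GaoUllmo2025, Thm. 3.1] -/
theorem mem_divisorClassesSpan_biproduct_of_forall_exteriorPullback_eq
    (hA : ∀ c, IsCMTypeRealisation (Φ' c) (A' c) (ι' c) (θ' c))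
    (hOrth : ∀ c c', c ≠ c' → ∀ f : A' c ⟶ A' c', f = 0) (hComm : ∀ (c) (f g : A' c ⟶ A' c), f ≫ g = g ≫ f)
    (cls : Fin (n + 1) → C) {h : ∀ c, complexBetti (A' c).X 2}
    (hros : ∀ (c) (a ac : 𝓞 (K' c)), (ac : K' c) = IsCMField.complexConj (K' c) (a : K' c) →
      ∀ x y : complexBetti (A' c).X 1,
        polarizationPairingOne (A' c).X (h c) ((A' c).dim - 1) (complexBetti.map (ι' c a).hom.hom.hom 1 x) y =
          polarizationPairingOne (A' c).X (h c) ((A' c).dim - 1) x (complexBetti.map (ι' c ac).hom.hom.hom 1 y))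
    (p : ℕ) (x : complexBetti (⨁ fun i => A' (cls i)).X (2 * p))
    (hx : ∀ u ∈ unitaryCentralizerGroup (⨁ fun i => A' (cls i))
        (sumPolarizationClass (fun i => A' (cls i)) fun i => h (cls i)),
      exteriorPullback (AbelianVariety.hasExteriorCohomologyH1_complexPoints (⨁ fun i => A' (cls i)))
        (u : complexBetti (⨁ fun i => A' (cls i)).X 1 →ₗ[ℂ] complexBetti (⨁ fun i => A' (cls i)).X 1)
        (2 * p) x = x) :
    x ∈ divisorClassesSpan (⨁ fun i => A' (cls i)).X (⨁ fun i => A' (cls i)).dim p := by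
  classical
  letI : LinearOrder ((i : Fin (n + 1)) × (K' (cls i) →+* ℂ)) :=
    LinearOrder.lift' (Fintype.equivFin _) (Fintype.equivFin _).injective
  -- eigenbases of the factors and the eigenbasis `w` of `H¹(B)`
  have hvex : ∀ c, ∃ v : Module.Basis (K' c →+* ℂ) ℂ (complexBetti (A' c).X 1),
      (∀ (σ : K' c →+* ℂ) (a : K' c), θ' c a (v σ) = σ a • v σ) ∧
      ∀ (σ : K' c →+* ℂ) (a : 𝓞 (K' c)), complexBetti.map (ι' c a).hom.hom.hom 1 (v σ) = σ (a : K' c) • v σ :=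
    fun c => Deligne1982.exists_eigenbasis_of_isCMTypeRealisation (hA c)
  choose v _hv hv' using hvex
  obtain ⟨w, hw⟩ := exists_biproductBasis_sigma (fun i => A' (cls i)) (fun i => v (cls i))
  have hwι : ∀ (a : ∀ i : Fin (n + 1), 𝓞 (K' (cls i))) (y : (i : Fin (n + 1)) × (K' (cls i) →+* ℂ)),
      complexBetti.map (biproduct.map fun i => ι' (cls i) (a i)).hom.hom.hom 1 (w y) =
        y.2 ((a y.1 : 𝓞 (K' (cls y.1))) : K' (cls y.1)) • w y := fun a y => by
    rw [hw y, map_biproductMap_map_π, hv', map_smul]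
  obtain ⟨b, hb⟩ := exists_monomialBasis w (2 * p)
  -- the support of `x` in the monomial basis is balanced for every weight
  have hsupp : ∀ s : Set.powersetCard ((i : Fin (n + 1)) × (K' (cls i) →+* ℂ)) (2 * p), b.repr x s ≠ 0 →
      ∀ ω : (c : C) × (K' c →+* ℂ),
        ((s : Finset ((i : Fin (n + 1)) × (K' (cls i) →+* ℂ))).filter fun y =>
            (⟨cls y.1, y.2⟩ : (c : C) × (K' c →+* ℂ)) = ω).card =
          ((s : Finset ((i : Fin (n + 1)) × (K' (cls i) →+* ℂ))).filter fun y =>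
            (⟨cls y.1, y.2⟩ : (c : C) × (K' c →+* ℂ)) = ⟨ω.1, conjugate ω.2⟩).card := by
    intro s hs ω
    obtain ⟨u, hu, d, hd, hiff⟩ :=
      exists_torusElement_unitaryCentralizerGroup_biproduct hA hOrth hComm hv' hw hros ω (cls := cls)
    have hdiag : ∀ t, exteriorPullback (AbelianVariety.hasExteriorCohomologyH1_complexPoints (⨁ fun i => A' (cls i)))
        (u : complexBetti (⨁ fun i => A' (cls i)).X 1 →ₗ[ℂ] complexBetti (⨁ fun i => A' (cls i)).X 1)
          (2 * p) (b t) = (∏ y ∈ (t : Finset ((i : Fin (n + 1)) × (K' (cls i) →+* ℂ))), d y) • b t :=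
      exteriorPullback_monomial_eq_prod_smul hb _ (fun y => by rw [LinearEquiv.coe_coe, hd])
    have h1 : ∏ y ∈ (s : Finset ((i : Fin (n + 1)) × (K' (cls i) →+* ℂ))), d y = 1 := by
      by_contra hne
      exact hs (repr_eq_zero_of_apply_eq_smul_of_apply_eq_self b hdiag (hx u hu) hne)
    exact hiff _ h1
  -- `Dᵖ ⊗ ℂ` is the span of the monomials over the disjoint unions of balanced pairs
  have hA' : ∀ i : Fin (n + 1), IsCMTypeRealisation (Φ' (cls i)) (A' (cls i)) (ι' (cls i)) (θ' (cls i)) :=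
    fun i => hA (cls i)
  have hS : ∀ S ∈ pohlmannDivisorSetsAlg (fun i => Φ' (cls i)) p, S.card = 2 * p := fun S hS =>
    (pohlmannDivisorSetsAlg_subset_pohlmannSetsAlg _ p hS).1
  rw [divisorClassesSpan_biproduct_eq_iSup hA' p, iSup_weightClassesAlg_eq_span_image hwι (fun s => hb s) hS,
    Module.Basis.mem_span_image]
  intro s hs
  exact mem_pohlmannDivisorSetsAlg_of_forall_card_filter_eq Φ' cls p s s.2
    (hsupp s (Finsupp.mem_support_iff.1 hs))

/-- **The polarization package of `B = ⨁ᵢ A_{cls i}`**: a class `D ∈ B¹(B) ⊗ ℂ` with `D^{dim B} ≠ 0` and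
non-degenerate `Q_D` (Milne's product divisor `Σᵢ πᵢ^* h_{cls i}` of Rosati–Kähler classes of the factors, Shimura
§6.2 Thm. 4 (3)) such that EVERY class of `H^{2p}(B(ℂ); ℂ)` fixed by `⋀^{2p} S(B)(ℂ)` lies in `Dᵖ(B) ⊗ ℂ` — the
form consumed by transport along isogenies. [cite: Milne1999LefschetzClasses, §1 p. 643, Thm. 3.2 and p. 657]
[cite: Shimura1998, §6.2 Theorem 4 (3)] -/
theorem exists_polarization_invariants_le_biproduct_of_classes
    (hA : ∀ c, IsCMTypeRealisation (Φ' c) (A' c) (ι' c) (θ' c))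
    (hOrth : ∀ c c', c ≠ c' → ∀ f : A' c ⟶ A' c', f = 0) (hComm : ∀ (c) (f g : A' c ⟶ A' c), f ≫ g = g ≫ f)
    (cls : Fin (n + 1) → C) :
    ∃ D : complexBetti (⨁ fun i => A' (cls i)).X 2,
      D ∈ hodgeClassSpan (⨁ fun i => A' (cls i)).dim (⨁ fun i => A' (cls i)).X 1 ∧
      lefschetzPow D ((⨁ fun i => A' (cls i)).dim - 1) 2 D ≠ 0 ∧
      (∀ z : complexBetti (⨁ fun i => A' (cls i)).X 1,
        (∀ y, polarizationPairingOne (⨁ fun i => A' (cls i)).X D ((⨁ fun i => A' (cls i)).dim - 1) z y = 0) →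
          z = 0) ∧
      ∀ (p : ℕ) (x : complexBetti (⨁ fun i => A' (cls i)).X (2 * p)),
        (∀ u ∈ unitaryCentralizerGroup (⨁ fun i => A' (cls i)) D,
          exteriorPullback (AbelianVariety.hasExteriorCohomologyH1_complexPoints (⨁ fun i => A' (cls i)))
            (u : complexBetti (⨁ fun i => A' (cls i)).X 1 →ₗ[ℂ] complexBetti (⨁ fun i => A' (cls i)).X 1)
            (2 * p) x = x) →
        x ∈ divisorClassesSpan (⨁ fun i => A' (cls i)).X (⨁ fun i => A' (cls i)).dim p := by
  have hr := fun c => (hA c).exists_rosati_kaehlerClass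
  choose h hQ _halg hK hros using hr
  have h0 : ∀ i : Fin (n + 1), 0 < (A' (cls i)).dim := fun i => dim_pos_of_isCMTypeRealisation' (hA (cls i))
  have hh : ∀ i : Fin (n + 1), h (cls i) ∈ hodgeClassSpan (A' (cls i)).dim (A' (cls i)).X 1 := fun i => by
    obtain ⟨s, hs, hKs⟩ := hK (cls i)
    exact mem_hodgeClassSpan_one_of_isKaehlerClass_smul (hQ _) hs hKs
  have htop : ∀ i : Fin (n + 1),
      lefschetzPow (h (cls i)) ((A' (cls i)).dim - 1) 2 (h (cls i)) ≠ 0 := fun i => by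
    obtain ⟨s, hs, hKs⟩ := hK (cls i)
    exact lefschetzPow_self_ne_zero_of_isKaehlerClass_smul (h0 i) hKs
  have hnd : ∀ (i : Fin (n + 1)) (z : complexBetti (A' (cls i)).X 1),
      (∀ y, polarizationPairingOne (A' (cls i)).X (h (cls i)) ((A' (cls i)).dim - 1) z y = 0) → z = 0 :=
    fun i => by
      obtain ⟨s, hs, hKs⟩ := hK (cls i)
      exact eq_zero_of_forall_polarizationPairingOne_eq_zero_of_isKaehlerClass_smul' hs hKs
  obtain ⟨HH, HT, HN⟩ := sumPolarizationClass_hypotheses (fun i => A' (cls i)) (fun i => h (cls i)) h0 hh htop hnd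
  exact ⟨_, HH, HT, HN, fun p x hx =>
    mem_divisorClassesSpan_biproduct_of_forall_exteriorPullback_eq hA hOrth hComm cls hros p x hx⟩

/-- **Milne 1999, Cor. 4.5 (with Thm. 4.4 and Thm. 3.2) — the conclusion of the record
`Milne1999_specialLefschetzGroup_invariants_le` — for every biproduct `B = ⨁ᵢ A_{cls i}` of copies of pairwise
`Hom`-orthogonal CM realisations with commutative endomorphism rings** (Milne's `A₁^{r₁} × ⋯ × A_s^{r_s}`,
`Aᵢ` simple of CM type, pairwise non-isogenous — up to the order of the factors): every class
`x ∈ H^{2p}(B(ℂ); ℂ)` fixed by `specialLefschetzGroup (dim B) B.X` lies in `Dᵖ_hom(B)_ℂ`.  The Künneth family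
`⋀•(u^{⊕(a+1)})` of `u ∈ S(B)(ℂ)` lies in `specialLefschetzGroup` (the tree's
`exteriorPullbackEquiv_mem_specialLefschetzGroup`, Thm. 4.4), so `⋀^{2p}u` fixes `x`, and
`mem_divisorClassesSpan_biproduct_of_forall_exteriorPullback_eq` applies.
[cite: Milne1999LefschetzClasses, Cor. 4.5 and p. 659, Thm. 3.2, Lemma 3.8 and p. 657, Prop. 1.1]
[cite: Shimura1998, §6.2 Theorem 4 (3)] -/
theorem specialLefschetzGroup_invariants_le_biproduct_of_classes
    (hA : ∀ c, IsCMTypeRealisation (Φ' c) (A' c) (ι' c) (θ' c))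
    (hOrth : ∀ c c', c ≠ c' → ∀ f : A' c ⟶ A' c', f = 0) (hComm : ∀ (c) (f g : A' c ⟶ A' c), f ≫ g = g ≫ f)
    (cls : Fin (n + 1) → C) (p : ℕ) (x : complexBetti (⨁ fun i => A' (cls i)).X (2 * p))
    (hx : ∀ g ∈ specialLefschetzGroup (⨁ fun i => A' (cls i)).dim (⨁ fun i => A' (cls i)).X, g (2 * p) x = x) :
    x ∈ divisorClassesSpan (⨁ fun i => A' (cls i)).X (⨁ fun i => A' (cls i)).dim p := by
  obtain ⟨D, HH, HT, HN, H⟩ := exists_polarization_invariants_le_biproduct_of_classes hA hOrth hComm cls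
  have hB0 : 0 < (⨁ fun i => A' (cls i)).dim :=
    dim_biproduct_pos _ (dim_pos_of_isCMTypeRealisation' (hA (cls 0)))
  exact H p x fun u hu => hx _ (exteriorPullbackEquiv_mem_specialLefschetzGroup hB0 HH HT HN hu)

/-- **Cor. 4.5 as an equality of sets on `B = ⨁ᵢ A_{cls i}`**: the `S(B)`-invariants of `H^{2p}(B(ℂ); ℂ)` are
EXACTLY `Dᵖ_hom(B)_ℂ`. [cite: Milne1999LefschetzClasses, Cor. 4.5 (p. 659)] -/
theorem setOf_forall_apply_eq_self_eq_divisorClassesSpan_biproduct_of_classes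
    (hA : ∀ c, IsCMTypeRealisation (Φ' c) (A' c) (ι' c) (θ' c))
    (hOrth : ∀ c c', c ≠ c' → ∀ f : A' c ⟶ A' c', f = 0) (hComm : ∀ (c) (f g : A' c ⟶ A' c), f ≫ g = g ≫ f)
    (cls : Fin (n + 1) → C) (p : ℕ) :
    {x : complexBetti (⨁ fun i => A' (cls i)).X (2 * p) |
        ∀ g ∈ specialLefschetzGroup (⨁ fun i => A' (cls i)).dim (⨁ fun i => A' (cls i)).X, g (2 * p) x = x} =
      (divisorClassesSpan (⨁ fun i => A' (cls i)).X (⨁ fun i => A' (cls i)).dim p : Set _) :=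
  Set.Subset.antisymm
    (fun x hx => specialLefschetzGroup_invariants_le_biproduct_of_classes hA hOrth hComm cls p x hx)
    fun _ hx _ hg => apply_eq_self_of_mem_specialLefschetzGroup hg hx

/-- **Milne Prop. 4.8, (c) ⇒ (a) on `B` itself, record-free**: if `Hg′(B) = S(B)` then `B = ⨁ᵢ A_{cls i}`
supports no exotic Hodge class (`IsDivisorGenerated B`). [cite: Milne1999LefschetzClasses, Prop. 4.8 and
Cor. 4.5 (pp. 659–660)] -/
theorem isDivisorGenerated_biproduct_of_hodgeGroup_eq_specialLefschetzGroup_of_classes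
    (hA : ∀ c, IsCMTypeRealisation (Φ' c) (A' c) (ι' c) (θ' c))
    (hOrth : ∀ c c', c ≠ c' → ∀ f : A' c ⟶ A' c', f = 0) (hComm : ∀ (c) (f g : A' c ⟶ A' c), f ≫ g = g ≫ f)
    (cls : Fin (n + 1) → C)
    (hHg : hodgeGroup (⨁ fun i => A' (cls i)).dim (⨁ fun i => A' (cls i)).X =
      specialLefschetzGroup (⨁ fun i => A' (cls i)).dim (⨁ fun i => A' (cls i)).X) :
    IsDivisorGenerated (⨁ fun i => A' (cls i)) :=
  fun p c hc hpp => specialLefschetzGroup_invariants_le_biproduct_of_classes hA hOrth hComm cls p c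
    fun _ hg => apply_eq_self_of_mem_hodgeGroup (hHg ▸ hg) hc hpp

end Main

/-! ### §6 Corollaries: pairwise `Hom`-orthogonal products, powers of one realisation, isogenies, and every
power of a simple complex abelian variety of CM type -/

section Corollaries

/-- **Products `⨁ᵢ Aᵢ` of pairwise `Hom`-orthogonal CM realisations with commutative `End(Aᵢ)`**
(`A₁ × ⋯ × A_s`, `Aᵢ` simple of CM type, pairwise non-isogenous; "`C(A) = C(A₁) × ⋯ × C(A_s)` if and only if
`Hom(Aᵢ, Aⱼ) = 0`"): the `S`-invariants of `H^{2p}` are divisor classes.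
[cite: Milne1999LefschetzClasses, §1 p. 643, Thm. 3.2 and p. 657, Cor. 4.5] -/
theorem specialLefschetzGroup_invariants_le_biproduct_of_hom_eq_zero {n : ℕ} {K : Fin (n + 1) → Type}
    [∀ i, Field (K i)] [∀ i, NumberField (K i)] [∀ i, IsCMField (K i)] {Φ : ∀ i, CMType (K i)}
    {A : Fin (n + 1) → AbelianVariety ℂ} {ι : ∀ i, 𝓞 (K i) →+* End (A i)}
    {θ : ∀ i, K i →+* Module.End ℂ (complexBetti (A i).X 1)}
    (hA : ∀ i, IsCMTypeRealisation (Φ i) (A i) (ι i) (θ i)) (hOrth : ∀ i j, i ≠ j → ∀ f : A i ⟶ A j, f = 0)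
    (hComm : ∀ (i) (f g : A i ⟶ A i), f ≫ g = g ≫ f) (p : ℕ) (x : complexBetti (⨁ A).X (2 * p))
    (hx : ∀ g ∈ specialLefschetzGroup (⨁ A).dim (⨁ A).X, g (2 * p) x = x) :
    x ∈ divisorClassesSpan (⨁ A).X (⨁ A).dim p :=
  specialLefschetzGroup_invariants_le_biproduct_of_classes (A' := A) hA hOrth hComm id p x hx

/-- **Powers `⨁_{Fin (n+1)} A` of ONE CM realisation with commutative `End(A)`** (a simple CM abelian variety;
"the diagonal action of `C(A)` on `rV(A)` identifies `C(A)` with `C(A^r)`", so `S(A^r) = S(A)` is still the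
torus, each weight `ξ_σ` now of multiplicity `r`): the `S`-invariants of `H^{2p}` are divisor classes.
[cite: Milne1999LefschetzClasses, §1 p. 643, Thm. 3.2, Lemma 3.8 and p. 657 ("each has the same multiplicity"), Cor. 4.5] -/
theorem specialLefschetzGroup_invariants_le_biproduct_const {K : Type} [Field K] [NumberField K] [IsCMField K]
    {Φ : CMType K} {A : AbelianVariety ℂ} {ι : 𝓞 K →+* End A} {θ : K →+* Module.End ℂ (complexBetti A.X 1)}
    (hA : IsCMTypeRealisation Φ A ι θ) (hEnd : ∀ φ ψ : A ⟶ A, φ ≫ ψ = ψ ≫ φ) (n p : ℕ)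
    (x : complexBetti (⨁ fun _ : Fin (n + 1) => A).X (2 * p))
    (hx : ∀ g ∈ specialLefschetzGroup (⨁ fun _ : Fin (n + 1) => A).dim (⨁ fun _ : Fin (n + 1) => A).X,
      g (2 * p) x = x) :
    x ∈ divisorClassesSpan (⨁ fun _ : Fin (n + 1) => A).X (⨁ fun _ : Fin (n + 1) => A).dim p :=
  specialLefschetzGroup_invariants_le_biproduct_of_classes (C := Unit) (K' := fun _ => K) (Φ' := fun _ => Φ)
    (A' := fun _ => A) (ι' := fun _ => ι) (θ' := fun _ => θ) (fun _ => hA) (fun _ _ h => absurd rfl h)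
    (fun _ => hEnd) (fun _ : Fin (n + 1) => ()) p x hx

/-- **Transport along an isogeny onto a target with a polarization package**: if `f : A ⟶ B` is an isogeny
and `B` carries `D ∈ B¹(B) ⊗ ℂ` with `D^{dim B} ≠ 0`, non-degenerate `Q_D`, and the property "every class fixed
by `⋀ S(B)(ℂ)` is a divisor class", then every class of `H^{2p}(A(ℂ); ℂ)` fixed by `specialLefschetzGroup (dim A) A.X`
lies in `Dᵖ(A) ⊗ ℂ` ("`S(A)` depends only on the isogeny class of `A`", §1 p. 644: `f^* ∘ u ∘ (f^*)⁻¹ ∈ S(A)(ℂ)`,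
the tree's `isogenyConj_mem_unitaryCentralizerGroup_iff`; `Dᵖ(A) ⊗ ℂ = f^*(Dᵖ(B) ⊗ ℂ)`).
[cite: Milne1999LefschetzClasses, §1 p. 644, Thm. 4.4 and Cor. 4.5] [cite: vanGeemen1994HodgeAV, §2.4 and §3.6] -/
theorem specialLefschetzGroup_invariants_le_of_isIsogeny_of_forall {A B : AbelianVariety ℂ} {f : A ⟶ B}
    (hf : AbelianVariety.IsIsogeny f) (hB0 : 0 < B.dim) {D : complexBetti B.X 2}
    (hh : D ∈ hodgeClassSpan B.dim B.X 1) (htop : lefschetzPow D (B.dim - 1) 2 D ≠ 0)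
    (hnd : ∀ z : complexBetti B.X 1, (∀ y, polarizationPairingOne B.X D (B.dim - 1) z y = 0) → z = 0)
    (hB : ∀ (p : ℕ) (y : complexBetti B.X (2 * p)),
      (∀ u ∈ unitaryCentralizerGroup B D,
        exteriorPullback (AbelianVariety.hasExteriorCohomologyH1_complexPoints B)
          (u : complexBetti B.X 1 →ₗ[ℂ] complexBetti B.X 1) (2 * p) y = y) →
      y ∈ divisorClassesSpan B.X B.dim p)
    (p : ℕ) (x : complexBetti A.X (2 * p)) (hx : ∀ g ∈ specialLefschetzGroup A.dim A.X, g (2 * p) x = x) :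
    x ∈ divisorClassesSpan A.X A.dim p := by
  have hdim : A.dim = B.dim := AbelianVariety.dim_eq_of_isIsogeny hf
  have hA0 : 0 < A.dim := hdim ▸ hB0
  obtain ⟨hh', htop', hnd'⟩ := polarization_hypotheses_map hf hh htop hnd
  set y : complexBetti B.X (2 * p) :=
    exteriorPullback (AbelianVariety.hasExteriorCohomologyH1_complexPoints A)
      ((isogenyPullbackOne hf).symm : complexBetti A.X 1 →ₗ[ℂ] complexBetti B.X 1) (2 * p) x with hy_def
  have hy : ∀ u ∈ unitaryCentralizerGroup B D,
      exteriorPullback (AbelianVariety.hasExteriorCohomologyH1_complexPoints B)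
        (u : complexBetti B.X 1 →ₗ[ℂ] complexBetti B.X 1) (2 * p) y = y := by
    intro u hu
    have hv : isogenyConj hf u ∈ unitaryCentralizerGroup A (complexBetti.map f.hom.hom.hom 2 D) :=
      (isogenyConj_mem_unitaryCentralizerGroup_iff hf D).2 hu
    exact exteriorPullback_apply_eq_self_of_isogenyConj hf u (2 * p)
      (hx _ (exteriorPullbackEquiv_mem_specialLefschetzGroup hA0 hh' htop' hnd' hv))
  have hyD : y ∈ divisorClassesSpan B.X B.dim p := hB p y hy
  rw [← map_exteriorPullback_isogenyPullbackOne_symm hf (2 * p) x, ← divisorClassesSpan_map_eq_of_isIsogeny hf p]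
  exact Submodule.mem_map_of_mem hyD

/-- **Everything isogenous to a `B = ⨁ᵢ A_{cls i}` as above**: if `f : X ⟶ ⨁ᵢ A_{cls i}` is an isogeny then
every class of `H^{2p}(X(ℂ); ℂ)` fixed by `specialLefschetzGroup (dim X) X.X` lies in `Dᵖ(X) ⊗ ℂ` (Prop. 1.1:
"there exists an isogeny `A₁^{r₁} × ⋯ × A_s^{r_s} → A`"; `S` and `D_hom` are isogeny invariants).
[cite: Milne1999LefschetzClasses, §1 p. 644 and Prop. 1.1, Cor. 4.5] -/
theorem specialLefschetzGroup_invariants_le_of_isIsogeny_biproduct_of_classes {C : Type} {K' : C → Type}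
    [∀ c, Field (K' c)] [∀ c, NumberField (K' c)] [∀ c, IsCMField (K' c)] {Φ' : ∀ c, CMType (K' c)}
    {A' : C → AbelianVariety ℂ} {ι' : ∀ c, 𝓞 (K' c) →+* End (A' c)}
    {θ' : ∀ c, K' c →+* Module.End ℂ (complexBetti (A' c).X 1)} {n : ℕ}
    (hA : ∀ c, IsCMTypeRealisation (Φ' c) (A' c) (ι' c) (θ' c))
    (hOrth : ∀ c c', c ≠ c' → ∀ f : A' c ⟶ A' c', f = 0) (hComm : ∀ (c) (f g : A' c ⟶ A' c), f ≫ g = g ≫ f)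
    (cls : Fin (n + 1) → C) {X : AbelianVariety ℂ} {f : X ⟶ ⨁ fun i => A' (cls i)}
    (hf : AbelianVariety.IsIsogeny f) (p : ℕ) (x : complexBetti X.X (2 * p))
    (hx : ∀ g ∈ specialLefschetzGroup X.dim X.X, g (2 * p) x = x) :
    x ∈ divisorClassesSpan X.X X.dim p := by
  obtain ⟨D, HH, HT, HN, H⟩ := exists_polarization_invariants_le_biproduct_of_classes hA hOrth hComm cls
  have hB0 : 0 < (⨁ fun i => A' (cls i)).dim :=
    dim_biproduct_pos _ (dim_pos_of_isCMTypeRealisation' (hA (cls 0)))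
  exact specialLefschetzGroup_invariants_le_of_isIsogeny_of_forall hf hB0 HH HT HN H p x hx

/-- **Milne 1999, Cor. 4.5 (with Thm. 4.4 and Thm. 3.2) for EVERY POWER `X^{N+1}` of a simple complex abelian
variety of CM type** (`AbelianVariety.IsSimple X`, `0 < dim X`, `IsOfCMType X`; no realisation data): every class
`x ∈ H^{2p}(X^{N+1}(ℂ); ℂ)` fixed by `specialLefschetzGroup (dim X^{N+1}) (X^{N+1}).X` lies in `Dᵖ_hom(X^{N+1})_ℂ`.
Proof: `X` is isogenous to a CM-typed `X′` with commutative `End` (`exists_isCMTyped_isIsogenous_of_isSimple`,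
Milne 1999b §2 p. 54), `X^{N+1} ∼ X′^{N+1} ≅ ⨁_{Fin (N+1)} X′`, and the torus argument with multiplicity `N + 1`
(`specialLefschetzGroup_invariants_le_biproduct_const`) transports along the isogeny.
[cite: Milne1999LefschetzClasses, Cor. 4.5, Thm. 3.2, Lemma 3.8 and p. 657, §1 p. 643–644]
[cite: Milne1999, §2 p. 54] [cite: MumfordAV1970, §19 Cor. 2 of Thm. 1 (p. 174)] -/
theorem specialLefschetzGroup_invariants_le_powSucc_of_isSimple_of_isOfCMType {X : AbelianVariety ℂ}
    (hXs : AbelianVariety.IsSimple X) (hX0 : 0 < X.dim) (hCM : IsOfCMType X) (N p : ℕ)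
    (x : complexBetti (X.powSucc N).X (2 * p))
    (hx : ∀ g ∈ specialLefschetzGroup (X.powSucc N).dim (X.powSucc N).X, g (2 * p) x = x) :
    x ∈ divisorClassesSpan (X.powSucc N).X (X.powSucc N).dim p := by
  obtain ⟨X', hX'T, hiso⟩ := exists_isCMTyped_isIsogenous_of_isSimple X hXs hX0 hCM
  obtain @⟨K, _, _, _, Φ, _, ι, θ, hX'⟩ := hX'T
  obtain ⟨g, hg⟩ := hiso
  have hX's : AbelianVariety.IsSimple X' := hXs.of_isIsogeny hg
  have hX'CM : IsOfCMType X' := hCM.of_isIsogeny hg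
  have hEnd : ∀ φ ψ : X' ⟶ X', φ ≫ ψ = ψ ≫ φ := comp_comm_of_isSimple_of_isOfCMType hX's hX'CM
  obtain ⟨f, hf⟩ := (isIsogenous_powSucc ⟨g, hg⟩ N).trans (isIsogenous_powSucc_biproduct X' N)
  obtain ⟨D, HH, HT, HN, H⟩ := exists_polarization_invariants_le_biproduct_of_classes (C := Unit)
    (K' := fun _ => K) (Φ' := fun _ => Φ) (A' := fun _ => X') (ι' := fun _ => ι) (θ' := fun _ => θ)
    (fun _ => hX') (fun _ _ h => absurd rfl h) (fun _ => hEnd) (fun _ : Fin (N + 1) => ())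
  have hB0 : 0 < (⨁ fun _ : Fin (N + 1) => X').dim :=
    dim_biproduct_pos (fun _ : Fin (N + 1) => X') ((AbelianVariety.dim_eq_of_isIsogeny hg) ▸ hX0)
  exact specialLefschetzGroup_invariants_le_of_isIsogeny_of_forall hf hB0 HH HT HN H p x hx

/-- **Cor. 4.5 as an equality of sets on the powers of a simple complex CM abelian variety.**
[cite: Milne1999LefschetzClasses, Cor. 4.5 (p. 659)] -/
theorem setOf_forall_apply_eq_self_eq_divisorClassesSpan_powSucc_of_isSimple_of_isOfCMType
    {X : AbelianVariety ℂ} (hXs : AbelianVariety.IsSimple X) (hX0 : 0 < X.dim) (hCM : IsOfCMType X) (N p : ℕ) :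
    {x : complexBetti (X.powSucc N).X (2 * p) |
        ∀ g ∈ specialLefschetzGroup (X.powSucc N).dim (X.powSucc N).X, g (2 * p) x = x} =
      (divisorClassesSpan (X.powSucc N).X (X.powSucc N).dim p : Set _) :=
  Set.Subset.antisymm
    (fun x hx => specialLefschetzGroup_invariants_le_powSucc_of_isSimple_of_isOfCMType hXs hX0 hCM N p x hx)
    fun _ hx _ hg => apply_eq_self_of_mem_specialLefschetzGroup hg hx

/-- **Milne Prop. 4.8, (c) ⇒ (a) on the powers of a simple complex CM abelian variety, record-free**: if
`Hg′(X^{N+1}) = S(X^{N+1})` then `X^{N+1}` supports no exotic Hodge class.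
[cite: Milne1999LefschetzClasses, Prop. 4.8 and Cor. 4.5 (pp. 659–660)] -/
theorem isDivisorGenerated_powSucc_of_hodgeGroup_eq_specialLefschetzGroup_of_isSimple_of_isOfCMType
    {X : AbelianVariety ℂ} (hXs : AbelianVariety.IsSimple X) (hX0 : 0 < X.dim) (hCM : IsOfCMType X) (N : ℕ)
    (hHg : hodgeGroup (X.powSucc N).dim (X.powSucc N).X = specialLefschetzGroup (X.powSucc N).dim (X.powSucc N).X) :
    IsDivisorGenerated (X.powSucc N) :=
  fun p c hc hpp => specialLefschetzGroup_invariants_le_powSucc_of_isSimple_of_isOfCMType hXs hX0 hCM N p c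
    fun _ hg => apply_eq_self_of_mem_hodgeGroup (hHg ▸ hg) hc hpp

end Corollaries

end Literature.AlgebraicGeometry.Milne1999

end
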